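import Summits.BirchSwinnertonDyer.BirchSwinnertonDyer.Theses.TwistFamilyManinDescent
import Literature.NumberTheory.EllipticCurves.GaloisAction
import Literature.NumberTheory.EllipticCurves.ModularSymbols

/-!
# Sketch — crux idea `igusa-cusp-anchor` for
`TwistFamilyManinDescent.EisensteinAdditiveManinResidual` (stmt-BirchSwinnertonDyer-25138)

Typed shadow of the line (statements only, no proofs, no `sorry`):

* `CaseA` — the ÉTALE-OUT condition on the rational `p`-line of `W` in explicit Newton-slope form
  (the kernel polynomial of the line on the short `p`-minimal model `y² = x³ − c₄/48·x − c₆/864`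
  has all roots of `p`-adic valuation `≥ v_p(Δ_min)/6`, i.e. the points of the line reduce to
  NON-ZERO points of the good model over the tame field; kit job j316851: every optimal curve on a
  potentially-ordinary reducible additive row with `p² ∣ N ≤ 400` is Case A, its `p`-isogenous
  partner is not).
* `LineInCuspImage` — the E-side shadow of the cuspidal anchor (K1 of the card is J-side:
  `ι(C) ⊆ Cusp(J₀(N))`; applying `φ_*` gives `deg φ · C ⊆ φ_*(Cusp)`, and `φ` of a cusp `r` is
  `uniformize (c · {∞, r}_f)`), typed with the tree's `modularSymbol` and `D.uniformize`.
* `OptimalOrdinaryCornerEtaleOutCuspidal` — FIRST LEMMA of the line (instrument-born).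
* `CaseAOrdinaryCornerManinUnit` — what the anchor delivers: the crux on the ordinary corner rows
  under the Case-A hypothesis (the complement `optimal ⇒ Case A` is LINE 18R's I9/I9♯ territory).
-/

open scoped MatrixGroups ModularForm
open CongruenceSubgroup Polynomial
open Literature.NumberTheory.EllipticCurves.ModularForms

namespace Summit.BirchSwinnertonDyer.BirchSwinnertonDyer.Cruxes.EisensteinAdditiveManinResidual.IgusaCuspAnchor

/-- The ordinary-corner rows of the crux (`e = 12/gcd(12,v) = p − 1` or the `(7; IV/IV*)` rows with
`e = 3 ∣ 6`): `p = 5, v ∈ {3, 9}` (III/III*), `p = 7, v ∈ {2, 4, 8, 10}` (II/IV/IV*/II*);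
same row list as `OrdinaryCornerOptimalSerreTateDeep` (stmt-27660). -/
def OrdinaryCornerRow (W : WeierstrassCurve ℚ) [W.IsGloballyMinimal] (p : ℕ) : Prop :=
  (p = 5 ∧ padicValInt 5 W.minimalDiscriminantInt ∈ ({3, 9} : Finset ℕ)) ∨
  (p = 7 ∧ padicValInt 7 W.minimalDiscriminantInt ∈ ({2, 4, 8, 10} : Finset ℕ))

/-- Newton-slope condition: every root of the (monic) polynomial `h ∈ ℚ[X]` has `p`-adic valuation
`≥ lam`, stated on coefficients: `v_p(coeff of X^{d-i}) ≥ i·lam` (a vanishing coefficient imposes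
nothing). [folklore: Newton polygon] -/
def RootValuationsAtLeast (p : ℕ) (lam : ℚ) (h : ℚ[X]) : Prop :=
  ∀ i ≤ h.natDegree, h.coeff (h.natDegree - i) = 0 ∨
    (i : ℚ) * lam ≤ (padicValRat p (h.coeff (h.natDegree - i)) : ℚ)

/-- A `Γ_ℚ`-stable line in `E[p]` (a rational `p`-isogeny kernel). -/
def IsRationalLine (W : WeierstrassCurve ℚ) (p : ℕ) (H : AddSubgroup (W.geomTorsion p)) : Prop :=
  (∀ σ : Field.absoluteGaloisGroup ℚ, ∀ P ∈ H, σ • P ∈ H) ∧ H ≠ ⊥ ∧ H ≠ ⊤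

/-- `h` is the kernel polynomial of the line `H` ON THE SHORT MODEL `y² = x³ − (c₄/48)x − c₆/864`
(whose `x`-coordinate is `x_W + b₂/12` and whose discriminant equals `Δ_W`; for `W` globally
minimal and `p ≥ 5` it is `p`-integral and `p`-minimal): monic of degree `(p−1)/2` vanishing at
`x(P) + b₂/12` for every affine `P ∈ H`. -/
def IsKernelPolyOnShortModel (W : WeierstrassCurve ℚ) (p : ℕ) (H : AddSubgroup (W.geomTorsion p))
    (h : ℚ[X]) : Prop :=
  h.Monic ∧ 2 * h.natDegree + 1 = p ∧
  ∀ P ∈ H, ∀ (x y : AlgebraicClosure ℚ)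
    (hxy : (W.baseChange (AlgebraicClosure ℚ)).toAffine.Nonsingular x y),
    ((P : W.geomTorsion p) : W.geomPoints) =
      (WeierstrassCurve.Affine.Point.some x y hxy : (W.baseChange (AlgebraicClosure ℚ)).toAffine.Point) →
    Polynomial.aeval (x + algebraMap ℚ (AlgebraicClosure ℚ) (W.b₂ / 12)) h = 0

/-- **Étale-out line (Case A).** The points of the rational line `H` reduce to NON-ZERO points of
the good model over the tame field `ℚ_p^{nr}(p^{1/e})`: on the short `p`-minimal model this is
`v_p(x(P)) ≥ v_p(Δ_min)/6` for all `P ∈ H ∖ 0`, i.e. the Newton slopes of the kernel polynomial are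
`≥ v/6`. (Case B = the line is the canonical subgroup: slopes `< v/6`.) -/
def IsEtaleOutLine (W : WeierstrassCurve ℚ) [W.IsGloballyMinimal] (p : ℕ)
    (H : AddSubgroup (W.geomTorsion p)) : Prop :=
  ∃ h : ℚ[X], IsKernelPolyOnShortModel W p H h ∧
    RootValuationsAtLeast p ((padicValInt p W.minimalDiscriminantInt : ℚ) / 6) h

/-- **Case A** for `(W, p)`: some rational `p`-line of `W` is étale-out. -/
def CaseA (W : WeierstrassCurve ℚ) [W.IsGloballyMinimal] (p : ℕ) : Prop :=
  ∃ H : AddSubgroup (W.geomTorsion p), IsRationalLine W p H ∧ IsEtaleOutLine W p H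

/-- The image under the modular parametrisation of the cuspidal divisor `∑_{r ∈ s} n(r)·((r) − (∞))`:
`φ_*(∑ n_r ((r) − (∞))) = uniformize (c · ∑ n_r {∞, r}_f)` (`φ(r) = uniformize (c·{∞,r}_f)`,
`φ(∞) = O`; Cremona §2.8, §2.10). -/
noncomputable def cuspImagePoint {W : WeierstrassCurve ℚ} {N : ℕ} [NeZero N]
    (D : ModularParametrizationData W N) (s : Finset ℚ) (n : ℚ → ℤ) :
    (W.baseChange ℂ).toAffine.Point :=
  D.uniformize ((D.c : ℂ) * ∑ r ∈ s, (n r : ℂ) * modularSymbol D.f r)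

/-- **E-side shadow of the cuspidal anchor:** `E` has a point of order `p` in `φ_*(Cusp J₀(N))`.
(The J-side statement K1 `ι(C) ⊆ Cusp(J₀(N))` implies `p ∣ deg φ ∨ LineInCuspImage`.) -/
def LineInCuspImage {W : WeierstrassCurve ℚ} {N : ℕ} [NeZero N]
    (D : ModularParametrizationData W N) (p : ℕ) : Prop :=
  ∃ (s : Finset ℚ) (n : ℚ → ℤ), cuspImagePoint D s n ≠ 0 ∧ p • cuspImagePoint D s n = 0

/-- **FIRST LEMMA (L1, instrument-born; kit j316830/j316851, c-free).** On the ordinary-corner rows,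
an OPTIMAL (`Λ_W ⊆ c·Λ_f`) curve with `E[p]` reducible and additive `p*`-twist is Case A (its
rational `p`-line is étale-out), and its line is visible in the image of the cuspidal group
(E-side shadow of K1). Evidence: 7/7 optimal curves on potentially-ordinary reducible rows with
`p² ∣ N ≤ 400` (150a1, 150b1, 175a1, 175c1, 275b1; 294a1, 294b1) are Case A with the `p`-line inside
`Cusp(J₀(N)) ∩ A_f` (Sage), their `p`-isogenous partners are Case B; 17/17 reducible additive optimal
curves have cuspidal `p`-line. -/
def OptimalOrdinaryCornerEtaleOutCuspidal : Prop :=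
  ∀ (W : WeierstrassCurve ℚ) [W.IsElliptic] [W.IsGloballyMinimal] {N : ℕ} [NeZero N]
    (D : ModularParametrizationData W N) (p : ℕ) (hp : p.Prime),
    OrdinaryCornerRow W p → p ^ 2 ∣ N → ¬ W.HasIrreducibleModPGaloisRep p →
    ¬ ((W.quadraticTwist (((-1 : ℤ) ^ (p / 2) * p : ℤ) : ℚ)).HasGoodReductionAt
          ((Rat.HeightOneSpectrum.primesEquiv (R := ℤ)).symm ⟨p, hp⟩) ∨
        (W.quadraticTwist (((-1 : ℤ) ^ (p / 2) * p : ℤ) : ℚ)).HasMultiplicativeReductionAt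
          ((Rat.HeightOneSpectrum.primesEquiv (R := ℤ)).symm ⟨p, hp⟩)) →
    (∀ z ∈ D.L.lattice, ∃ w ∈ periodLattice D.f, z = D.c * w) →
    CaseA W p ∧ (p ∣ D.modularDegree ∨ LineInCuspImage D p)

/-- **What the anchor delivers (C⁺ ⇒ this ⇒ crux on the ordinary corner, given `optimal ⇒ Case A`).**
The crux `EisensteinAdditiveManinResidual` restricted to the ordinary-corner rows under the Case-A
hypothesis: for an étale-out optimal curve the Manin constant is prime to `p`. The card's line:
Tate rigidity kills the multiplicative part of `G = ker(ℰ_{U,s} → 𝒥_{U,s})` (stmt-27661's step),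
Case A makes the étale part of `ℰ_{U,s}[p]` the reduction of the global line `C = ⟨P₀⟩`,
K1 writes `ι(P₀) = [D₀]` with `D₀` cuspidal, and K2 (E-blind) shows `[D₀]` does not specialise to
`0` on Edixhoven's stable fibre of `X₀(p²M)` over `U`; hence `G = 0`, `ι` is a closed immersion
over `U`, and `p ∤ c` (Edixhoven 1991 Prop. 2 / thesis 4.6). -/
def CaseAOrdinaryCornerManinUnit : Prop :=
  ∀ (W : WeierstrassCurve ℚ) [W.IsElliptic] [W.IsGloballyMinimal] {N : ℕ} [NeZero N]
    (D : ModularParametrizationData W N) (p : ℕ) (hp : p.Prime),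
    OrdinaryCornerRow W p → p ^ 2 ∣ N → ¬ W.HasIrreducibleModPGaloisRep p →
    ¬ ((W.quadraticTwist (((-1 : ℤ) ^ (p / 2) * p : ℤ) : ℚ)).HasGoodReductionAt
          ((Rat.HeightOneSpectrum.primesEquiv (R := ℤ)).symm ⟨p, hp⟩) ∨
        (W.quadraticTwist (((-1 : ℤ) ^ (p / 2) * p : ℤ) : ℚ)).HasMultiplicativeReductionAt
          ((Rat.HeightOneSpectrum.primesEquiv (R := ℤ)).symm ⟨p, hp⟩)) →
    (∀ z ∈ D.L.lattice, ∃ w ∈ periodLattice D.f, z = D.c * w) →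
    CaseA W p → ¬ (p : ℤ) ∣ D.maninConstant

end Summit.BirchSwinnertonDyer.BirchSwinnertonDyer.Cruxes.EisensteinAdditiveManinResidual.IgusaCuspAnchor
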